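import Summits.CriticalPhenomena.CardyFormulaZ2.Theorems.HalfPlaneMarkDensityLaw.Negative.MarkEvents
import Literature.Probability.Percolation.ClusterBoundary

/-!
# `HalfPlaneMarkDensityLaw` (crux stmt-CriticalPhenomena-5661), line `Sketch`, Positivity Q5–Q7:
# the `H`-cluster toolkit (`stub_mem_hCluster_iff`, `stub_hCluster_measurable`, `stub_hCluster_indep`)

The `H`-cluster of the boundary vertex `bpt k = (k,0)` — the set of sites joined to `(k,0)` by an
open path inside the lattice half-plane `H = halfPlane = {v | 0 ≤ v 1}` — is realised as the
ORDINARY open cluster `openCluster ωH (bpt k)` of the restricted configuration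
`ωH := ω ∩ EH`, `EH := {e | ∀ v ∈ e, v ∈ halfPlane}` (only the pairs with both endpoints in `H` are
kept), so that the toolkit of `Literature.Probability.Percolation.ClusterBoundary` (`clusterIs`,
`determinedBy_clusterIs`, `measurableSet_clusterIs`, `disjoint_edgesTouching_compl_sym2`) applies:

* Q5 `stub_mem_hCluster_iff`: `v ∈ openCluster ωH (bpt k) ↔ ω ∈ openConnIn halfPlane (bpt k) v`
  (an open walk of `ωH` from `(k,0) ∈ H` has `ω`-open edges and stays in `H`; conversely a walk of
  the graph induced on `H` by the open graph of `ω` is a walk of the open graph of `ωH`);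
* Q7 `stub_hCluster_measurable`: `{K_H(k) = S}` is the preimage of `clusterIs (bpt k) S` under the
  measurable restriction `ω ↦ ω ∩ EH`;
* Q6 `stub_hCluster_indep`: `{K_H(k) = S}` is determined by the pairs touching `S`, hence
  (`bondPercolation_real_inter_of_disjoint`) independent of every measurable event determined by
  the pairs inside `Sᶜ`.
-/

noncomputable section

namespace Summit.CriticalPhenomena.CardyFormulaZ2.Cruxes.HalfPlaneMarkDensityLaw.SketchLine

open Literature.Probability.Percolation Literature.Probability.LatticeModels
open MeasureTheory Filter Set SimpleGraph
open scoped Topology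
open Summit.CriticalPhenomena.CardyFormulaZ2.Theorems.HalfPlaneMarkDensityLaw.Negative

namespace Positivity

/-- An open walk of the restricted configuration `ω ∩ EH` starting in `H` witnesses a connection
inside `H` in `ω`. [folklore] -/
theorem hCluster_openConnIn_of_walk {ω : BondConfig (Site 2)} :
    ∀ {u z : Site 2} (_ : (openGraph (ω ∩ {e : Sym2 (Site 2) | ∀ v ∈ e, v ∈ halfPlane})).Walk u z),
      u ∈ halfPlane → ω ∈ openConnIn halfPlane u z := by
  intro u z w
  induction w with
  | nil => intro hu; exact openConnIn_refl hu
  | @cons a b c hab w ih =>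
    intro ha
    obtain ⟨⟨hω, hE⟩, hne⟩ := (openGraph_adj _ a b).1 hab
    have hb : b ∈ halfPlane := hE b (Sym2.mem_mk_right a b)
    exact PlanarDuality.openConnIn_trans (openConnIn_of_adj ha hb hω hne) (ih hb)

/-- STUB Q5 (the `H`-cluster): the cluster of `(k,0)` in the configuration restricted to the edges of `H` is the set of sites joined to `(k,0)` inside `H`. [folklore] -/
theorem stub_mem_hCluster_iff :
    ∀ (ω : BondConfig (Site 2)) (k : ℤ) (v : Site 2),
      v ∈ openCluster (ω ∩ {e : Sym2 (Site 2) | ∀ v ∈ e, v ∈ halfPlane}) (bpt k) ↔ ω ∈ openConnIn halfPlane (bpt k) v := by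
  intro ω k v
  constructor
  · rintro ⟨w⟩
    -- `bpt k ∈ halfPlane` since `(bpt k) 1 = 0` (tree: `SelfDual.bpt_mem_halfPlane`)
    exact hCluster_openConnIn_of_walk w (by simp [bpt, halfPlane])
  · rintro ⟨hx, hy, h⟩
    let φ : (openGraph ω).induce halfPlane →g openGraph (ω ∩ {e : Sym2 (Site 2) | ∀ v ∈ e, v ∈ halfPlane}) :=
      { toFun := fun a => a.1
        map_rel' := fun {a b} hab => by
          rw [SimpleGraph.comap_adj, Function.Embedding.coe_subtype, openGraph_adj] at hab
          rw [openGraph_adj]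
          refine ⟨⟨hab.1, fun u hu => ?_⟩, hab.2⟩
          rcases Sym2.mem_iff.1 hu with rfl | rfl
          exacts [a.2, b.2] }
    exact h.map φ

/-- The restriction `ω ↦ ω ∩ EH` to the pairs inside `H` is measurable. [folklore] -/
theorem hCluster_measurable_restrict :
    Measurable fun ω : BondConfig (Site 2) => ω ∩ {e : Sym2 (Site 2) | ∀ v ∈ e, v ∈ halfPlane} :=
  (measurable_inter_edgeSigma _).mono (edgeSigma_le _) le_rfl

/-- STUB Q7 (measurability of the `H`-cluster event). [folklore] -/
theorem stub_hCluster_measurable :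
    ∀ (k : ℤ) (S : Finset (Site 2)),
      MeasurableSet {ω : BondConfig (Site 2) | openCluster (ω ∩ {e : Sym2 (Site 2) | ∀ v ∈ e, v ∈ halfPlane}) (bpt (k)) = ↑S} := by
  intro k S
  exact hCluster_measurable_restrict (measurableSet_clusterIs (bpt k) S)

/-- The `H`-cluster event `{K_H(k) = S}` is determined by the pairs touching `S`. [folklore] -/
theorem hCluster_determinedBy (k : ℤ) (S : Finset (Site 2)) :
    DeterminedBy {ω : BondConfig (Site 2) | openCluster (ω ∩ {e : Sym2 (Site 2) | ∀ v ∈ e, v ∈ halfPlane}) (bpt (k)) = ↑S}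
      (edgesTouching (↑S : Set (Site 2))) := by
  rw [determinedBy_iff]
  intro ω ω' h
  have h' : ω ∩ {e : Sym2 (Site 2) | ∀ v ∈ e, v ∈ halfPlane} ∩ edgesTouching (↑S : Set (Site 2)) =
      ω' ∩ {e : Sym2 (Site 2) | ∀ v ∈ e, v ∈ halfPlane} ∩ edgesTouching (↑S : Set (Site 2)) := by
    rw [Set.inter_right_comm, h, Set.inter_right_comm]
  exact (determinedBy_iff _ _).1 (determinedBy_clusterIs (bpt k) S) _ _ h'

/-- STUB Q6 (independence): the event "the `H`-cluster of `(k,0)` is `S`" is independent of every measurable event determined by the pairs off `S`. [folklore] -/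
theorem stub_hCluster_indep :
    ∀ (k : ℤ) (S : Finset (Site 2)) (B : Set (BondConfig (Site 2))),
      DeterminedBy B ((↑S : Set (Site 2))ᶜ).sym2 → MeasurableSet B →
      μ.real ({ω : BondConfig (Site 2) | openCluster (ω ∩ {e : Sym2 (Site 2) | ∀ v ∈ e, v ∈ halfPlane}) (bpt (k)) = ↑S} ∩ B) =
        μ.real {ω : BondConfig (Site 2) | openCluster (ω ∩ {e : Sym2 (Site 2) | ∀ v ∈ e, v ∈ halfPlane}) (bpt (k)) = ↑S} * μ.real B := by
  intro k S B hB hBm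
  unfold μ
  exact bondPercolation_real_inter_of_disjoint (zdGraph 2) half
    (disjoint_edgesTouching_compl_sym2 (↑S : Set (Site 2))) (hCluster_determinedBy k S) hB
    (stub_hCluster_measurable k S) hBm

end Positivity

end Summit.CriticalPhenomena.CardyFormulaZ2.Cruxes.HalfPlaneMarkDensityLaw.SketchLine
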